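import Summits.AnomalousDissipation.AnomalousDissipation.Theorems.MomentParityQuarticGateDesignSymMeasure
import Summits.AnomalousDissipation.AnomalousDissipation.Theorems.MomentParityQuarticGateDesignSymLaw

/-!
# Stub `stub_order2DesignSym` (S6′) of the line `axis-sectors`
# (crux `MomentParity.QuarticGate`, stmt-AnomalousDissipation-11464)

**The symmetric loud order-2 Kolmogorov design.** Force `f = cos(2πx₁) e₀` (shear invariant: it
depends on `x₁` only), `E = 2`, `ε = 1/2`, `ν₀ = 1/(16π²)`. For `0 < ν < ν₀` and
`N ≥ N₀ = ⌈1/ν⌉ + 2` the order-2 design is the uniform law on the `16 · #FrameIdx` atoms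
`cf + cA m + cB m ± cC ± cR a` of `MomentParityQuarticGateDesignSums` with `B₂ = 1/2`,
`A₁ = 2(1 - 4π²ν)/π` (linear rows), `η = 1/N` (noise), and the carrier amplitude `c` solving the
enstrophy balance exactly (energy row; dissipation `= 1/2`); its clauses are
`MomentParityQuarticGateDesignSymMeasure`. The symmetric design at shear period `L` is its average
over the shear group `H_L` (`exists_lawSym_of_design`, file `…DesignSymLaw`): level, support, rows,
energy and dissipation are inherited, the covariance stays nondegenerate, and the cylindrical laws
become `H_L`-invariant. Statement copied byte-for-byte from the registered skeleton
`Cruxes/QuarticGate/Lines/axis-sectors.lean`.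
-/

-- `Summit.<Summit>.<Problem>` is the tree's mandated summit-side namespace (CONVENTIONS §2); for this
-- single-conjunct summit the two coincide, so the duplicate is deliberate.
set_option linter.dupNamespace false

namespace Summit.AnomalousDissipation.AnomalousDissipation.Theorems.MomentParityQuarticGate

open MeasureTheory Filter Complex
open scoped InnerProductSpace RealInnerProductSpace ComplexConjugate ENNReal
open Literature.Analysis.FunctionSpaces Literature.Analysis.FluidPDE
open Summit.AnomalousDissipation.AnomalousDissipation.Theses.MomentParity
open Summit.AnomalousDissipation.AnomalousDissipation.Theorems.QuarticGate.Negative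

noncomputable section

/-! ## The force -/

/-- **The Kolmogorov force as a real trigonometric polynomial on `{±(0,1,0)}`**: smooth, divergence
free, mean zero, shear invariant, with Fourier coefficients the force family `cf`. [folklore] -/
theorem kolmogorovForce_facts {cf : (Fin 3 → ℤ) → EuclideanSpace ℂ (Fin 3)}
    (hcf : cf = (Pi.single (![0, 1, 0] : Fin 3 → ℤ) (((1 / 2 : ℂ)) • EuclideanSpace.complexify (WithLp.toLp 2 ![(1 : ℝ), 0, 0] : EuclideanSpace ℝ (Fin 3))) +
        Pi.single (-(![0, 1, 0] : Fin 3 → ℤ)) ((starRingEnd ℂ) ((1 / 2 : ℂ)) • EuclideanSpace.complexify (WithLp.toLp 2 ![(1 : ℝ), 0, 0] : EuclideanSpace ℝ (Fin 3))) : (Fin 3 → ℤ) → EuclideanSpace ℂ (Fin 3)))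
    {f : UnitAddTorus (Fin 3) → EuclideanSpace ℝ (Fin 3)}
    (hf : f = Torus.realTrigPoly ({(![0, 1, 0] : Fin 3 → ℤ), -(![0, 1, 0] : Fin 3 → ℤ)} : Finset (Fin 3 → ℤ)) cf) :
    Torus.IsSmooth f ∧ Torus.IsDivFree f ∧ Torus.HasZeroMean f ∧
      (∀ a : UnitAddTorus (Fin 3), a 1 = 0 → ∀ x, f (x + a) = f x) ∧
      ∀ k, UnitAddTorus.mFourierCoeff (EuclideanSpace.complexify ∘ f) k = cf k := by
  subst hf
  have hS : ∀ k ∈ ({(![0, 1, 0] : Fin 3 → ℤ), -(![0, 1, 0] : Fin 3 → ℤ)} : Finset (Fin 3 → ℤ)), -k ∈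
      ({(![0, 1, 0] : Fin 3 → ℤ), -(![0, 1, 0] : Fin 3 → ℤ)} : Finset (Fin 3 → ℤ)) := by decide
  have h0 : (0 : Fin 3 → ℤ) ∉ ({(![0, 1, 0] : Fin 3 → ℤ), -(![0, 1, 0] : Fin 3 → ℤ)} : Finset (Fin 3 → ℤ)) := by decide
  have hax : ∀ k ∈ ({(![0, 1, 0] : Fin 3 → ℤ), -(![0, 1, 0] : Fin 3 → ℤ)} : Finset (Fin 3 → ℤ)), k 0 = 0 ∧ k 2 = 0 := by decide
  obtain ⟨hF, -⟩ := design_dots 0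
  have hconj : Torus.IsConjSymm cf := hcf ▸ isConjSymm_single_add_single _ _ _
  have htr : Torus.IsTransversal ({(![0, 1, 0] : Fin 3 → ℤ), -(![0, 1, 0] : Fin 3 → ℤ)} : Finset (Fin 3 → ℤ)) cf :=
    hcf ▸ isTransversal_single_add_single _ _ (by simpa only [mul_comm] using hF)
  refine ⟨Torus.isSmooth_realTrigPoly _ _, Torus.isDivFree_realTrigPoly htr, hasZeroMean_realTrigPoly_of_zero_not_mem h0 cf,
    fun a ha x => realTrigPoly_comp_add_right_of_axial hax cf ha x, fun k => ?_⟩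
  rw [Torus.mFourierCoeff_realTrigPoly hS hconj]
  split_ifs with hk
  · rfl
  · have h1 : k ≠ (![0, 1, 0] : Fin 3 → ℤ) := fun h => hk (by rw [h]; decide)
    have h2 : k ≠ -(![0, 1, 0] : Fin 3 → ℤ) := fun h => hk (by rw [h]; decide)
    rw [hcf]
    exact (single_add_single_apply_eq_zero h1 h2 _ _).symm

/-! ## The parameters of the design -/

/-- **Choice of the design parameters** (pure real arithmetic): for `0 < ν < 1/(16π²)`,
`N ≥ ⌈1/ν⌉ + 2`, `A₁ = 2(1 - 4π²ν)/π`, `B₂ = 1/2`, `η = 1/N` and a noise enstrophy `Rn ≤ nA/2`, there is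
a carrier amplitude `c` with the linear-row relation, the enstrophy balance and the energy budget `≤ 2`.
[folklore] -/
theorem design_parameters {ν : ℝ} (hν : 0 < ν) (hνlt : ν < 1 / (16 * Real.pi ^ 2)) {N : ℕ}
    (hN : Nat.ceil (1 / ν) + 2 ≤ N) {A₁ B₂ η : ℝ} (hA₁ : A₁ = 2 * (1 - 4 * Real.pi ^ 2 * ν) / Real.pi)
    (hB₂ : B₂ = 1 / 2) (hη : η = 1 / N) {nA Rn : ℝ} (hnApos : 0 < nA) (hRn0 : 0 ≤ Rn) (hRnle : Rn ≤ nA * (1 / 2)) :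
    ∃ c : ℝ, η ≠ 0 ∧ Real.pi * A₁ * B₂ = 1 - 4 * Real.pi ^ 2 * ν ∧
      16 * nA * (1 / 2) = ν * (4 * Real.pi ^ 2 * (16 * nA * (1 / 2 + A₁ ^ 2 / 2 + 2 * B₂ ^ 2 + (N : ℝ) ^ 2 * c ^ 2 / 2) + 16 * Rn)) ∧
      1 / 2 + A₁ ^ 2 / 2 + B₂ ^ 2 + c ^ 2 / 2 + η ^ 2 / 2 ≤ 2 := by
  have hπ : 0 < Real.pi := Real.pi_pos
  have hN2 : 2 ≤ N := le_trans (Nat.le_add_left 2 _) hN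
  have hNpos : (0 : ℝ) < N := by exact_mod_cast (lt_of_lt_of_le (by norm_num) hN2)
  have hN1 : (1 : ℝ) ≤ N := by exact_mod_cast le_trans (by norm_num) hN2
  have hNν : 1 / ν ≤ (N : ℝ) := (Nat.le_ceil _).trans (by exact_mod_cast le_trans (Nat.le_add_right _ 2) hN)
  have hνπ : ν * (16 * Real.pi ^ 2) < 1 := (lt_div_iff₀ (by positivity)).1 hνlt
  -- `1/(8π²ν) > 2`
  have hνinv : 2 < 1 / (8 * Real.pi ^ 2 * ν) := by
    rw [lt_div_iff₀ (by positivity)]; nlinarith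
  have hη0 : η ≠ 0 := by rw [hη]; positivity
  have hAB : Real.pi * A₁ * B₂ = 1 - 4 * Real.pi ^ 2 * ν := by
    rw [hA₁, hB₂, mul_comm Real.pi, div_mul_cancel₀ _ hπ.ne']; ring
  have hA₁sq : A₁ ^ 2 / 2 ≤ 1 / 4 := by
    have h1 : -1 ≤ 1 - 4 * Real.pi ^ 2 * ν ∧ 1 - 4 * Real.pi ^ 2 * ν ≤ 1 := by
      constructor <;> nlinarith [Real.pi_gt_three, hν.le]
    have h2 : A₁ ^ 2 = 4 * (1 - 4 * Real.pi ^ 2 * ν) ^ 2 / Real.pi ^ 2 := by rw [hA₁, div_pow]; ring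
    have h3 : (1 - 4 * Real.pi ^ 2 * ν) ^ 2 ≤ 1 := by nlinarith [h1.1, h1.2]
    rw [h2, div_div, div_le_iff₀ (by positivity)]
    nlinarith [Real.pi_gt_three]
  -- the carrier amplitude
  obtain ⟨D, hD⟩ : ∃ D : ℝ, D = 1 / (8 * Real.pi ^ 2 * ν) - Rn / nA - 1 - A₁ ^ 2 / 2 := ⟨_, rfl⟩
  have hRnA : Rn / nA ≤ 1 / 2 := by rw [div_le_iff₀ hnApos]; linarith
  have hRnA0 : 0 ≤ Rn / nA := div_nonneg hRn0 hnApos.le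
  have hD0 : 0 ≤ D := by rw [hD]; linarith
  have hDle : D ≤ 1 / (8 * Real.pi ^ 2 * ν) := by rw [hD]; nlinarith [sq_nonneg A₁]
  refine ⟨Real.sqrt (2 * D) / N, hη0, hAB, ?_, ?_⟩
  · have hcsq : (N : ℝ) ^ 2 * (Real.sqrt (2 * D) / N) ^ 2 / 2 = D := by
      have hN0 : (N : ℝ) ^ 2 ≠ 0 := by positivity
      rw [div_pow, Real.sq_sqrt (by linarith), ← mul_div_assoc, mul_comm ((N : ℝ) ^ 2), mul_div_assoc, div_self hN0, mul_one]
      ring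
    rw [hcsq, hD, hB₂]
    have hx : (8 * Real.pi ^ 2 * ν) ≠ 0 := by positivity
    have e1 : Rn / nA * nA = Rn := div_mul_cancel₀ Rn hnApos.ne'
    have e2 : 1 / (8 * Real.pi ^ 2 * ν) * (8 * Real.pi ^ 2 * ν) = 1 := one_div_mul_cancel hx
    linear_combination (64 * Real.pi ^ 2 * ν) * e1 + (-8 * nA) * e2
  · have hc2 : (Real.sqrt (2 * D) / N) ^ 2 / 2 ≤ 1 / 8 := by
      rw [div_pow, Real.sq_sqrt (by linarith)]
      have h1 : 2 * D / (N : ℝ) ^ 2 / 2 = D / (N : ℝ) ^ 2 := by ring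
      rw [h1, div_le_iff₀ (by positivity)]
      have h2 : D * ν ≤ 1 / (8 * Real.pi ^ 2) := by
        rw [le_div_iff₀ (by positivity)]
        have := (le_div_iff₀ (by positivity : (0 : ℝ) < 8 * Real.pi ^ 2 * ν)).1 hDle
        nlinarith
      have h3 : 1 ≤ (N : ℝ) * ν := by
        rw [div_le_iff₀ hν] at hNν; linarith
      have h5 : 1 / (8 * Real.pi ^ 2) ≤ 1 / 8 := by
        rw [div_le_div_iff₀ (by positivity) (by norm_num)]; nlinarith [Real.pi_gt_three]
      have h6 : (N : ℝ) ≤ (N : ℝ) ^ 2 := by nlinarith [hN1]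
      calc D ≤ D * ((N : ℝ) * ν) := le_mul_of_one_le_right hD0 h3
        _ = D * ν * N := by ring
        _ ≤ 1 / (8 * Real.pi ^ 2) * N := mul_le_mul_of_nonneg_right h2 hNpos.le
        _ ≤ 1 / 8 * N := mul_le_mul_of_nonneg_right h5 hNpos.le
        _ ≤ 1 / 8 * (N : ℝ) ^ 2 := mul_le_mul_of_nonneg_left h6 (by norm_num)
    have hη2 : η ^ 2 / 2 ≤ 1 / 2 := by
      rw [hη]
      have h1 : (1 / (N : ℝ)) ^ 2 ≤ 1 := by
        rw [div_pow, one_pow, div_le_one (by positivity)]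
        nlinarith [hN1]
      linarith
    rw [hB₂]
    nlinarith [hA₁sq, hc2, hη2]

/-! ## The order-2 design for the Kolmogorov force (stub S6 with the force exposed) -/

/-- **THE ORDER-2 DESIGN for the explicit Kolmogorov force** `f = realTrigPoly {±(0,1,0)} cf`
(`= cos(2πx₁) e₀`): `E = 2`, `ε = 1/2`, `ν₀ = 1/(16π²)`, `N₀ = ⌈1/ν⌉ + 2`; the law is the uniform
law on the atoms of the design with `B₂ = 1/2`, `A₁ = 2(1 - 4π²ν)/π`, `η = 1/N` and the carrier
amplitude `c` balancing the enstrophy. [folklore] -/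
theorem order2Design_kolmogorov {cf : (Fin 3 → ℤ) → EuclideanSpace ℂ (Fin 3)}
    (hcf : cf = (Pi.single (![0, 1, 0] : Fin 3 → ℤ) (((1 / 2 : ℂ)) • EuclideanSpace.complexify (WithLp.toLp 2 ![(1 : ℝ), 0, 0] : EuclideanSpace ℝ (Fin 3))) +
        Pi.single (-(![0, 1, 0] : Fin 3 → ℤ)) ((starRingEnd ℂ) ((1 / 2 : ℂ)) • EuclideanSpace.complexify (WithLp.toLp 2 ![(1 : ℝ), 0, 0] : EuclideanSpace ℝ (Fin 3))) : (Fin 3 → ℤ) → EuclideanSpace ℂ (Fin 3)))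
    {f : UnitAddTorus (Fin 3) → EuclideanSpace ℝ (Fin 3)}
    (hf : f = Torus.realTrigPoly ({(![0, 1, 0] : Fin 3 → ℤ), -(![0, 1, 0] : Fin 3 → ℤ)} : Finset (Fin 3 → ℤ)) cf) :
    ∀ ν : ℝ, 0 < ν → ν < 1 / (16 * Real.pi ^ 2) → ∃ N₀ : ℕ, ∀ N : ℕ, N₀ ≤ N →
      ∃ μ₀ : Measure (Torus.energySpace (Fin 3)), IsProbabilityMeasure μ₀ ∧ (∀ᵐ u ∂μ₀, IsLevel N u) ∧
      (∃ R : ℝ, ∀ᵐ u ∂μ₀, ‖u‖ ≤ R) ∧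
      (∀ g : UnitAddTorus (Fin 3) → EuclideanSpace ℝ (Fin 3), IsBandTest N g →
        (∃ u : Torus.energySpace (Fin 3), IsLevel N u ∧ Torus.pairing u.1 g ≠ 0) →
        (∫ u : Torus.energySpace (Fin 3), Torus.pairing u.1 g ∂μ₀) ^ 2 <
          ∫ u : Torus.energySpace (Fin 3), (Torus.pairing u.1 g) ^ 2 ∂μ₀) ∧
      (∀ g : UnitAddTorus (Fin 3) → EuclideanSpace ℝ (Fin 3), IsBandTest N g →
        Integrable (fun u : Torus.energySpace (Fin 3) => Torus.nsGeneratorPairing ν f u g) μ₀ ∧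
        ∫ u : Torus.energySpace (Fin 3), Torus.nsGeneratorPairing ν f u g ∂μ₀ = 0) ∧
      (Integrable (fun u : Torus.energySpace (Fin 3) => Torus.nsGeneratorPairing ν f u
          (Torus.fourierTruncate N (u.1 : UnitAddTorus (Fin 3) → EuclideanSpace ℝ (Fin 3)))) μ₀ ∧
        ∫ u : Torus.energySpace (Fin 3), Torus.nsGeneratorPairing ν f u
          (Torus.fourierTruncate N (u.1 : UnitAddTorus (Fin 3) → EuclideanSpace ℝ (Fin 3))) ∂μ₀ = 0) ∧
      (Integrable (fun u : Torus.energySpace (Fin 3) => Torus.nsGeneratorPairing ν f u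
          (BDSV.curl (Torus.fourierTruncate N (u.1 : UnitAddTorus (Fin 3) → EuclideanSpace ℝ (Fin 3))))) μ₀ ∧
        ∫ u : Torus.energySpace (Fin 3), Torus.nsGeneratorPairing ν f u
          (BDSV.curl (Torus.fourierTruncate N (u.1 : UnitAddTorus (Fin 3) → EuclideanSpace ℝ (Fin 3)))) ∂μ₀ = 0) ∧
      Torus.ensembleEnergy μ₀ ≤ 2 ∧ 1 / 2 ≤ Torus.ensembleDissipation ν μ₀ := by
  intro ν hν hνlt
  obtain ⟨hfs, -, -, -, hfF⟩ := kolmogorovForce_facts hcf hf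
  refine ⟨Nat.ceil (1 / ν) + 2, fun N hN => ?_⟩
  have hN2 : 2 ≤ N := le_trans (Nat.le_add_left 2 _) hN
  -- parameters
  obtain ⟨B₂, hB₂⟩ : ∃ B₂ : ℝ, B₂ = 1 / 2 := ⟨_, rfl⟩
  obtain ⟨A₁, hA₁⟩ : ∃ A₁ : ℝ, A₁ = 2 * (1 - 4 * Real.pi ^ 2 * ν) / Real.pi := ⟨_, rfl⟩
  obtain ⟨η, hη⟩ : ∃ η : ℝ, η = 1 / N := ⟨_, rfl⟩
  -- the coefficient families of the pair and of the noise
  obtain ⟨cA, hcA⟩ : ∃ cA : Fin 4 → (Fin 3 → ℤ) → EuclideanSpace ℂ (Fin 3), cA = fun m : Fin 4 => (Pi.single (![0, 0, 1] : Fin 3 → ℤ) ((((A₁ / 2 : ℝ) : ℂ) * Complex.I ^ (m : ℕ)) • EuclideanSpace.complexify (WithLp.toLp 2 ![(1 : ℝ), 0, 0] : EuclideanSpace ℝ (Fin 3))) +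
        Pi.single (-(![0, 0, 1] : Fin 3 → ℤ)) ((starRingEnd ℂ) (((A₁ / 2 : ℝ) : ℂ) * Complex.I ^ (m : ℕ)) • EuclideanSpace.complexify (WithLp.toLp 2 ![(1 : ℝ), 0, 0] : EuclideanSpace ℝ (Fin 3))) : (Fin 3 → ℤ) → EuclideanSpace ℂ (Fin 3)) := ⟨_, rfl⟩
  obtain ⟨cB, hcB⟩ : ∃ cB : Fin 4 → (Fin 3 → ℤ) → EuclideanSpace ℂ (Fin 3), cB = fun m : Fin 4 => (Pi.single (![0, 1, 1] : Fin 3 → ℤ) ((((B₂ / 2 : ℝ) : ℂ) * -Complex.I * Complex.I ^ (m : ℕ)) • EuclideanSpace.complexify (WithLp.toLp 2 ![(0 : ℝ), 1, -1] : EuclideanSpace ℝ (Fin 3))) +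
        Pi.single (-(![0, 1, 1] : Fin 3 → ℤ)) ((starRingEnd ℂ) (((B₂ / 2 : ℝ) : ℂ) * -Complex.I * Complex.I ^ (m : ℕ)) • EuclideanSpace.complexify (WithLp.toLp 2 ![(0 : ℝ), 1, -1] : EuclideanSpace ℝ (Fin 3))) : (Fin 3 → ℤ) → EuclideanSpace ℂ (Fin 3)) := ⟨_, rfl⟩
  obtain ⟨cR, hcR⟩ : ∃ cR : Torus.FrameIdx (Fin 3) N → (Fin 3 → ℤ) → EuclideanSpace ℂ (Fin 3), cR = fun a : Torus.FrameIdx (Fin 3) N => (Pi.single (a.1 : Fin 3 → ℤ) ((((η / 2 : ℝ) : ℂ) * (if a.2.2 then (1 : ℂ) else -Complex.I)) • EuclideanSpace.complexify (Torus.perpVec (a.1 : Fin 3 → ℤ) a.2.1)) +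
        Pi.single (-(a.1 : Fin 3 → ℤ)) ((starRingEnd ℂ) (((η / 2 : ℝ) : ℂ) * (if a.2.2 then (1 : ℂ) else -Complex.I)) • EuclideanSpace.complexify (Torus.perpVec (a.1 : Fin 3 → ℤ) a.2.1)) : (Fin 3 → ℤ) → EuclideanSpace ℂ (Fin 3)) := ⟨_, rfl⟩
  -- the noise enstrophy
  obtain ⟨Rn, hRn⟩ : ∃ Rn : ℝ, Rn = ∑ a : Torus.FrameIdx (Fin 3) N, ∑ k ∈ ((Torus.freqBall N).erase 0), Torus.freqNormSq k * ‖(cR a) k‖ ^ 2 := ⟨_, rfl⟩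
  obtain ⟨nA, hnA⟩ : ∃ nA : ℝ, nA = (Fintype.card (Torus.FrameIdx (Fin 3) N) : ℝ) := ⟨_, rfl⟩
  have hnApos : 0 < nA := by
    obtain ⟨hkF, -⟩ := design_mem hN2
    haveI : Nonempty (Torus.FrameIdx (Fin 3) N) := ⟨(⟨(![0, 1, 0] : Fin 3 → ℤ), hkF⟩, 0, true)⟩
    rw [hnA]; exact_mod_cast Fintype.card_pos
  have hRn0 : 0 ≤ Rn := hRn ▸ Finset.sum_nonneg fun a _ => Finset.sum_nonneg fun k _ =>
    mul_nonneg (Torus.freqNormSq_nonneg k) (sq_nonneg _)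
  have hRnle : Rn ≤ nA * (1 / 2) := by
    have h := design_sum_enstrophy_R_le (cR := cR) hcR
    have hNpos : (0 : ℝ) < N := by exact_mod_cast (lt_of_lt_of_le (by norm_num) hN2)
    have : (N : ℝ) ^ 2 * η ^ 2 / 2 = 1 / 2 := by
      rw [hη, div_pow, one_pow, ← mul_div_assoc, mul_one, div_self (by positivity)]
    rw [this, ← hRn, ← hnA] at h
    exact h
  have hcard : ((Fintype.card (Fin 4 × Torus.FrameIdx (Fin 3) N × Bool × Bool) : ℕ) : ℝ) = 16 * nA := by
    rw [hnA, Fintype.card_prod (Fin 4), Fintype.card_prod (Torus.FrameIdx (Fin 3) N), Fintype.card_prod Bool Bool,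
      Fintype.card_bool, Fintype.card_fin]
    push_cast; ring
  -- the carrier amplitude, the enstrophy balance and the energy budget
  obtain ⟨c, hη0, hAB, hbal, hEb⟩ := design_parameters hν hνlt hN hA₁ hB₂ hη hnApos hRn0 hRnle
  rw [← hcard, hRn] at hbal
  -- the uniform law on the atoms
  exact exists_design_measure (c := c) hcf hcA hcB rfl hcR hfs hfF hN2 hη0 ν hAB hbal hEb le_rfl

/-- **The symmetric order-2 design from an order-2 design with a shear-invariant force**
(conditional assembly of stub S6′ from the clauses of stub S6 for a GIVEN force): symmetrise the
level-`N` design at every requested `L ≥ 1` by `exists_lawSym_of_design`. [folklore] -/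
theorem order2DesignSym_of_design (f : UnitAddTorus (Fin 3) → EuclideanSpace ℝ (Fin 3))
    (hfs : Torus.IsSmooth f) (hfd : Torus.IsDivFree f) (hfz : Torus.HasZeroMean f)
    (hfa : ∀ a : UnitAddTorus (Fin 3), a 1 = 0 → ∀ x, f (x + a) = f x) (E ε ν₀ : ℝ) (hε : 0 < ε) (hν₀ : 0 < ν₀)
    (hS6 : ∀ ν : ℝ, 0 < ν → ν < ν₀ → ∃ N₀ : ℕ, ∀ N : ℕ, N₀ ≤ N →
      ∃ μ₀ : Measure (Torus.energySpace (Fin 3)), IsProbabilityMeasure μ₀ ∧ (∀ᵐ u ∂μ₀, IsLevel N u) ∧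
      (∃ R : ℝ, ∀ᵐ u ∂μ₀, ‖u‖ ≤ R) ∧
      (∀ g : UnitAddTorus (Fin 3) → EuclideanSpace ℝ (Fin 3), IsBandTest N g →
        (∃ u : Torus.energySpace (Fin 3), IsLevel N u ∧ Torus.pairing u.1 g ≠ 0) →
        (∫ u : Torus.energySpace (Fin 3), Torus.pairing u.1 g ∂μ₀) ^ 2 <
          ∫ u : Torus.energySpace (Fin 3), (Torus.pairing u.1 g) ^ 2 ∂μ₀) ∧
      (∀ g : UnitAddTorus (Fin 3) → EuclideanSpace ℝ (Fin 3), IsBandTest N g →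
        Integrable (fun u : Torus.energySpace (Fin 3) => Torus.nsGeneratorPairing ν f u g) μ₀ ∧
        ∫ u : Torus.energySpace (Fin 3), Torus.nsGeneratorPairing ν f u g ∂μ₀ = 0) ∧
      (Integrable (fun u : Torus.energySpace (Fin 3) => Torus.nsGeneratorPairing ν f u
          (Torus.fourierTruncate N (u.1 : UnitAddTorus (Fin 3) → EuclideanSpace ℝ (Fin 3)))) μ₀ ∧
        ∫ u : Torus.energySpace (Fin 3), Torus.nsGeneratorPairing ν f u
          (Torus.fourierTruncate N (u.1 : UnitAddTorus (Fin 3) → EuclideanSpace ℝ (Fin 3))) ∂μ₀ = 0) ∧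
      (Integrable (fun u : Torus.energySpace (Fin 3) => Torus.nsGeneratorPairing ν f u
          (BDSV.curl (Torus.fourierTruncate N (u.1 : UnitAddTorus (Fin 3) → EuclideanSpace ℝ (Fin 3))))) μ₀ ∧
        ∫ u : Torus.energySpace (Fin 3), Torus.nsGeneratorPairing ν f u
          (BDSV.curl (Torus.fourierTruncate N (u.1 : UnitAddTorus (Fin 3) → EuclideanSpace ℝ (Fin 3)))) ∂μ₀ = 0) ∧
      Torus.ensembleEnergy μ₀ ≤ E ∧ ε ≤ Torus.ensembleDissipation ν μ₀) :
    ∃ f : UnitAddTorus (Fin 3) → EuclideanSpace ℝ (Fin 3),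
    Torus.IsSmooth f ∧ Torus.IsDivFree f ∧ Torus.HasZeroMean f ∧
    (∀ a : UnitAddTorus (Fin 3), a 1 = 0 → ∀ x, f (x + a) = f x) ∧
    ∃ E ε ν₀ : ℝ, 0 < ε ∧ 0 < ν₀ ∧ ∀ ν : ℝ, 0 < ν → ν < ν₀ → ∃ N₀ : ℕ, ∀ N : ℕ, N₀ ≤ N →
    ∀ L : ℕ, 0 < L →
    ∃ μ₀ : Measure (Torus.energySpace (Fin 3)), IsProbabilityMeasure μ₀ ∧ (∀ᵐ u ∂μ₀, IsLevel N u) ∧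
    (∃ R : ℝ, ∀ᵐ u ∂μ₀, ‖u‖ ≤ R) ∧
    (∀ g : UnitAddTorus (Fin 3) → EuclideanSpace ℝ (Fin 3), IsBandTest N g →
      (∃ u : Torus.energySpace (Fin 3), IsLevel N u ∧ Torus.pairing u.1 g ≠ 0) →
      (∫ u : Torus.energySpace (Fin 3), Torus.pairing u.1 g ∂μ₀) ^ 2 <
        ∫ u : Torus.energySpace (Fin 3), (Torus.pairing u.1 g) ^ 2 ∂μ₀) ∧
    (∀ a : UnitAddTorus (Fin 3), a 1 = 0 → L • a = 0 →
      ∀ (m : ℕ) (g : Fin m → UnitAddTorus (Fin 3) → EuclideanSpace ℝ (Fin 3)),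
      (∀ i, IsBandTest N (g i)) →
      Measure.map (fun u : Torus.energySpace (Fin 3) => fun i => Torus.pairing u.1 (fun x => g i (x + a))) μ₀ =
        Measure.map (fun u : Torus.energySpace (Fin 3) => fun i => Torus.pairing u.1 (g i)) μ₀) ∧
    (∀ g : UnitAddTorus (Fin 3) → EuclideanSpace ℝ (Fin 3), IsBandTest N g →
      Integrable (fun u : Torus.energySpace (Fin 3) => Torus.nsGeneratorPairing ν f u g) μ₀ ∧
      ∫ u : Torus.energySpace (Fin 3), Torus.nsGeneratorPairing ν f u g ∂μ₀ = 0) ∧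
    (Integrable (fun u : Torus.energySpace (Fin 3) => Torus.nsGeneratorPairing ν f u
        (Torus.fourierTruncate N (u.1 : UnitAddTorus (Fin 3) → EuclideanSpace ℝ (Fin 3)))) μ₀ ∧
      ∫ u : Torus.energySpace (Fin 3), Torus.nsGeneratorPairing ν f u
        (Torus.fourierTruncate N (u.1 : UnitAddTorus (Fin 3) → EuclideanSpace ℝ (Fin 3))) ∂μ₀ = 0) ∧
    (Integrable (fun u : Torus.energySpace (Fin 3) => Torus.nsGeneratorPairing ν f u
        (BDSV.curl (Torus.fourierTruncate N (u.1 : UnitAddTorus (Fin 3) → EuclideanSpace ℝ (Fin 3))))) μ₀ ∧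
      ∫ u : Torus.energySpace (Fin 3), Torus.nsGeneratorPairing ν f u
        (BDSV.curl (Torus.fourierTruncate N (u.1 : UnitAddTorus (Fin 3) → EuclideanSpace ℝ (Fin 3)))) ∂μ₀ = 0) ∧
    Torus.ensembleEnergy μ₀ ≤ E ∧ ε ≤ Torus.ensembleDissipation ν μ₀ := by
  refine ⟨f, hfs, hfd, hfz, hfa, E, ε, ν₀, hε, hν₀, fun ν hν hνlt => ?_⟩
  obtain ⟨N₀, hN₀⟩ := hS6 ν hν hνlt
  refine ⟨N₀, fun N hN L hL => ?_⟩
  obtain ⟨μ, hp, hlev, hR, hnd, hlin, hErow, hHrow, hE, hD⟩ := hN₀ N hN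
  obtain ⟨μ₀, hp₀, hlev₀, hR₀, hnd₀, hsym₀, hlin₀, hErow₀, hHrow₀, hE₀, hD₀⟩ :=
    exists_lawSym_of_design ν hfa N L hL μ hp hlev hR hnd hlin hErow hHrow
  exact ⟨μ₀, hp₀, hlev₀, hR₀, hnd₀, hsym₀, hlin₀, hErow₀, hHrow₀, hE₀.trans_le hE, hD.trans_eq hD₀.symm⟩

/-- **S6′ — the symmetric loud ORDER-2 DESIGN, one explicit force (stub of the line `axis-sectors`,
statement verbatim from the registered skeleton).** Take the Kolmogorov force of
`order2Design_kolmogorov` (shear invariant by `kolmogorovForce_facts`) and symmetrise its order-2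
design over the finite shear group `H_L` (`order2DesignSym_of_design`). [folklore] -/
theorem stub_order2DesignSym :
    ∃ f : UnitAddTorus (Fin 3) → EuclideanSpace ℝ (Fin 3),
    Torus.IsSmooth f ∧ Torus.IsDivFree f ∧ Torus.HasZeroMean f ∧
    (∀ a : UnitAddTorus (Fin 3), a 1 = 0 → ∀ x, f (x + a) = f x) ∧
    ∃ E ε ν₀ : ℝ, 0 < ε ∧ 0 < ν₀ ∧ ∀ ν : ℝ, 0 < ν → ν < ν₀ → ∃ N₀ : ℕ, ∀ N : ℕ, N₀ ≤ N →
    ∀ L : ℕ, 0 < L →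
    ∃ μ₀ : Measure (Torus.energySpace (Fin 3)), IsProbabilityMeasure μ₀ ∧ (∀ᵐ u ∂μ₀, IsLevel N u) ∧
    (∃ R : ℝ, ∀ᵐ u ∂μ₀, ‖u‖ ≤ R) ∧
    (∀ g : UnitAddTorus (Fin 3) → EuclideanSpace ℝ (Fin 3), IsBandTest N g →
      (∃ u : Torus.energySpace (Fin 3), IsLevel N u ∧ Torus.pairing u.1 g ≠ 0) →
      (∫ u : Torus.energySpace (Fin 3), Torus.pairing u.1 g ∂μ₀) ^ 2 <
        ∫ u : Torus.energySpace (Fin 3), (Torus.pairing u.1 g) ^ 2 ∂μ₀) ∧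
    (∀ a : UnitAddTorus (Fin 3), a 1 = 0 → L • a = 0 →
      ∀ (m : ℕ) (g : Fin m → UnitAddTorus (Fin 3) → EuclideanSpace ℝ (Fin 3)),
      (∀ i, IsBandTest N (g i)) →
      Measure.map (fun u : Torus.energySpace (Fin 3) => fun i => Torus.pairing u.1 (fun x => g i (x + a))) μ₀ =
        Measure.map (fun u : Torus.energySpace (Fin 3) => fun i => Torus.pairing u.1 (g i)) μ₀) ∧
    (∀ g : UnitAddTorus (Fin 3) → EuclideanSpace ℝ (Fin 3), IsBandTest N g →
      Integrable (fun u : Torus.energySpace (Fin 3) => Torus.nsGeneratorPairing ν f u g) μ₀ ∧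
      ∫ u : Torus.energySpace (Fin 3), Torus.nsGeneratorPairing ν f u g ∂μ₀ = 0) ∧
    (Integrable (fun u : Torus.energySpace (Fin 3) => Torus.nsGeneratorPairing ν f u
        (Torus.fourierTruncate N (u.1 : UnitAddTorus (Fin 3) → EuclideanSpace ℝ (Fin 3)))) μ₀ ∧
      ∫ u : Torus.energySpace (Fin 3), Torus.nsGeneratorPairing ν f u
        (Torus.fourierTruncate N (u.1 : UnitAddTorus (Fin 3) → EuclideanSpace ℝ (Fin 3))) ∂μ₀ = 0) ∧
    (Integrable (fun u : Torus.energySpace (Fin 3) => Torus.nsGeneratorPairing ν f u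
        (BDSV.curl (Torus.fourierTruncate N (u.1 : UnitAddTorus (Fin 3) → EuclideanSpace ℝ (Fin 3))))) μ₀ ∧
      ∫ u : Torus.energySpace (Fin 3), Torus.nsGeneratorPairing ν f u
        (BDSV.curl (Torus.fourierTruncate N (u.1 : UnitAddTorus (Fin 3) → EuclideanSpace ℝ (Fin 3)))) ∂μ₀ = 0) ∧
    Torus.ensembleEnergy μ₀ ≤ E ∧ ε ≤ Torus.ensembleDissipation ν μ₀ := by
  obtain ⟨hfs, hfd, hfz, hfa, -⟩ := kolmogorovForce_facts rfl rfl
  exact order2DesignSym_of_design _ hfs hfd hfz hfa 2 (1 / 2) (1 / (16 * Real.pi ^ 2)) (by norm_num) (by positivity)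
    (order2Design_kolmogorov rfl rfl)

end

end Summit.AnomalousDissipation.AnomalousDissipation.Theorems.MomentParityQuarticGate
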